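import Literature.Computability.ImplicitComplexity.STAWeighted
import Literature.Computability.ImplicitComplexity.SoftTypeAssignmentTySubst
import Literature.Computability.ImplicitComplexity.SoftTypeAssignmentWeightedTy
import HarnessLib

/-!
# Substitution of types in weighted `STA` derivations

Support file for the `PTIME` soundness half of `STACapturesP` (GMR08 Thm. 3.5). The generation
lemma behind subject reduction must dispose of a `(∀I)` immediately followed by a `(∀E)`
(`Γ ⊢ λx.M : A ⟹ ∀α.A ⟹ A[B/α]`): this is done, as in [GR07, Lemma 4.2 (substitution of
types)], by substituting `B` for `α` directly inside the derivation of `Γ ⊢ λx.M : A`, which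
keeps size, rank, degree and weight. The σ-calculus of linear types and the operations
`SoftTy.substT` / `Ctx.substT` are in `SoftTypeAssignmentTySubst.lean`; here:

* pointwise companions (`LinTy.rename_congr`, `LinTy.substp_congr`, `LinTy.up_zero`,
  `LinTy.up_succ`, `LinTy.up_congr`) and the `(∀E)` substitution `LinTy.consT B` with
  `inst_eq_substp : A.inst B = A.substp (consT B)`, `SoftTy.substT_consT_shift`,
  `Ctx.substT_consT_shift` (instantiating a shifted context undoes the shift);
* `MTyping.substT` / `MTyping.shiftT` — the tree's type substitution lemma `WTyping.substT` /
  `WTyping.shiftT` (`SoftTypeAssignmentWeightedTy.lean`, GR07 Lemma 4.2 with measures) transported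
  to `MTyping` along `mtyping_iff_wtyping_and_sumFree` (one-liners: the subject is unchanged), and
  `MTyping.of_shift_inst` (`Γ.shift ⊢ M : A ⟹ Γ ⊢ M : A[B/α]`, the `(∀I)`/`(∀E)` détour).

## References

* [GaboardiMarionRonchidellarocca2008] GMR08, Table 2 (`(∀I)`, `(∀E)`), §3.
* [GaboardiRonchiDellaRocca2007] GR07, §4 (substitution of types in derivations keeps the
  measures).
-/

namespace Literature.Computability.ImplicitComplexity

namespace STA

/-! ### Pointwise companions for linear types -/

namespace LinTy

/-- Renaming respects pointwise equality. [folklore] -/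
theorem rename_congr {ρ₁ ρ₂ : ℕ → ℕ} (h : ∀ i, ρ₁ i = ρ₂ i) (A : LinTy) :
    A.rename ρ₁ = A.rename ρ₂ := by
  induction A generalizing ρ₁ ρ₂ with
  | tvar i => simp [LinTy.rename, h i]
  | limp k d c ihd ihc => simp [LinTy.rename, ihd h, ihc h]
  | all b ih => simp [LinTy.rename, ih (liftRen_congr h)]

/-- `up θ 0 = α₀`. [folklore] -/
@[simp] theorem up_zero (θ : ℕ → LinTy) : LinTy.up θ 0 = .tvar 0 := rfl

/-- `up θ (i+1) = (θ i)[succ]`. [folklore] -/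
@[simp] theorem up_succ (θ : ℕ → LinTy) (i : ℕ) : LinTy.up θ (i + 1) = (θ i).rename Nat.succ := rfl

/-- `up` respects pointwise equality. [folklore] -/
theorem up_congr {θ₁ θ₂ : ℕ → LinTy} (h : ∀ i, θ₁ i = θ₂ i) (i : ℕ) : LinTy.up θ₁ i = LinTy.up θ₂ i := by
  cases i with
  | zero => rfl
  | succ i => simp [h i]

/-- Substitution respects pointwise equality. [folklore] -/
theorem substp_congr {θ₁ θ₂ : ℕ → LinTy} (h : ∀ i, θ₁ i = θ₂ i) (A : LinTy) :
    A.substp θ₁ = A.substp θ₂ := by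
  induction A generalizing θ₁ θ₂ with
  | tvar i => simp [LinTy.substp, h i]
  | limp k d c ihd ihc => simp [LinTy.substp, ihd h, ihc h]
  | all b ih => simp [LinTy.substp, ih (up_congr h)]

/-- The substitution `[B/α₀, α₀/α₁, α₁/α₂, …]` of rule `(∀E)`. [folklore] -/
def consT (B : LinTy) : ℕ → LinTy
  | 0 => B
  | i + 1 => .tvar i

/-- `consT B 0 = B`. [folklore] -/
@[simp] theorem consT_zero (B : LinTy) : consT B 0 = B := rfl

/-- `consT B (i+1) = αᵢ`. [folklore] -/
@[simp] theorem consT_succ (B : LinTy) (i : ℕ) : consT B (i + 1) = .tvar i := rfl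

/-- `A[B/α]` is parallel substitution by `consT B`. [cite: GaboardiMarionRonchidellarocca2008, Table 2 (∀E)] -/
theorem inst_eq_substp (A B : LinTy) : A.inst B = A.substp (consT B) := by
  unfold LinTy.inst
  exact substp_congr (fun i => by cases i <;> rfl) A

end LinTy

/-- Instantiating a shifted soft type undoes the shift. [folklore] -/
theorem SoftTy.substT_consT_shift (B : LinTy) (σ : SoftTy) :
    (σ.shift).substT (LinTy.consT B) = σ := by
  cases σ with
  | mk k A =>
    simp only [SoftTy.substT, SoftTy.shift, SoftTy.mk.injEq, true_and]
    rw [← LinTy.inst_eq_substp]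
    exact LinTy.inst_rename_succ A B

/-- Instantiating a shifted context undoes the shift: `Γ.shift[B/α₀] = Γ`. [folklore] -/
theorem Ctx.substT_consT_shift (B : LinTy) (Γ : Ctx) : (Γ.shift).substT (LinTy.consT B) = Γ := by
  funext i
  simp only [Ctx.substT_apply, Ctx.shift, Option.map_map]
  cases Γ i with
  | none => rfl
  | some σ => exact congrArg some (SoftTy.substT_consT_shift B σ)

/-! ### The type substitution lemma -/

namespace MTyping

variable {r d w : ℕ} {Γ : Ctx} {M : Term} {σ : SoftTy}

/-- **Type substitution lemma** (GR07 Lemma 4.2 for `STA`, with measures): substituting linear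
types for type variables throughout a derivation yields a derivation of `Γ[θ] ⊢ M : σ[θ]` with
the same subject, rank bound, degree and weight. This is the tree's `WTyping.substT`
(`SoftTypeAssignmentWeightedTy.lean`, the formalisation of GR07's lemma for `STA₊`) transported
along `mtyping_iff_wtyping_and_sumFree` (the subject does not change).
[cite: GaboardiMarionRonchidellarocca2008, Table 2 and §3 (substitution of linear types)] -/
theorem substT (h : MTyping r w d Γ M σ) (θ : ℕ → LinTy) :
    MTyping r w d (Γ.substT θ) M (σ.substT θ) :=
  MTyping.of_wtyping (h.wtyping.substT θ) h.sumFree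

/-- Type renaming by `succ` (weakening of the type-variable context): `Γ ⊢ M : σ` gives
`Γ.shift ⊢ M : σ.shift`, same measures — the tree's `WTyping.shiftT` transported. [folklore] -/
theorem shiftT (h : MTyping r w d Γ M σ) : MTyping r w d Γ.shift M σ.shift :=
  MTyping.of_wtyping h.wtyping.shiftT h.sumFree

/-- **The `(∀I)`/`(∀E)` détour, eliminated**: from the premise `Γ.shift ⊢ M : A` of a `(∀I)` one
gets `Γ ⊢ M : A[B/α]` directly, with the same measures (instantiate `α₀ := B` inside the
derivation). [cite: GaboardiMarionRonchidellarocca2008, Table 2 (∀I), (∀E)] -/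
theorem of_shift_inst {A : LinTy} (h : MTyping r w d Γ.shift M ⟨0, A⟩) (B : LinTy) :
    MTyping r w d Γ M ⟨0, A.inst B⟩ := by
  have := h.substT (LinTy.consT B)
  rw [Ctx.substT_consT_shift] at this
  simp only [SoftTy.substT] at this
  rwa [LinTy.inst_eq_substp]

end MTyping

end STA

end Literature.Computability.ImplicitComplexity
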